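import Mathlib
import HarnessLib
import Summits.HubbardSuperconductivity.HubbardSuperconductivity.Theorems.KLProgrammeKLRegimeCountertermJacksonRemainderCertNoRateDefs

/-!
# Route `KLProgramme`, crux K3 — gen-8 ENGINE-FLOW child (stmt-HubbardSuperconductivity-20437 `KLRegimeEngineV17F2`), stub (C)
# `stub_twoLeg_curvature`: the (C1) certificate's linear forms EXPANDED — `T.bound a k` (`k ≤ 3`) and `T.boundNR a 4` as explicit sums

Seat hubbard-kl-k3c3-p1 (g8).  The (C) closer reads the (C1) rows at SYMBOLIC profile sizes `a l` (natural-size induction, k3c3-p3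
`C1-JETBOX-DEEP.md` §4.1) against a NUMERIC table of record (`klC1TableF128r/512/2048`, any future `…8192`).  These record-agnostic identities
remove the `Finset` bookkeeping once and for all: after `rw [CutoffDefectTable.bound_three]` (etc.) a `norm_num [klC1TableF2048]` evaluates the row.

* `CutoffDefectTable.bound_one/_two/_three/_four` — `T.bound a k` as an explicit linear combination of `a 0, …, a (k+1)`;
* `CutoffDefectTable.boundNR_one/_two/_three/_four` — the same for the no-rate form (`a 0, …, a k`);
* `CutoffDefectTable.value_le_of_le` / `bound_three_le_of_coeffs`-type use is left to the closer (the identities are equalities).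

Bookkeeping only (finite sums); nothing about the model is asserted; nothing asserts superconductivity.
-/

noncomputable section

namespace Summit.HubbardSuperconductivity.HubbardSuperconductivity.Theorems.KLRegimeSplit

set_option linter.dupNamespace false -- summit = problem name (single-conjunct summit), D-0017

/-! ## §1 The rate form `T.bound a k`, `k = 1 … 4` -/

/-- `T.bound a 1 = N₁·a₀ + (Tu₁ + N0)·a₁ + Td·a₂`. -/
theorem CutoffDefectTable.bound_one (T : CutoffDefectTable) (a : ℕ → ℝ) :
    T.bound a 1 = T.N 1 * a 0 + (T.Tu 1 + T.N0) * a 1 + T.Td * a 2 := by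
  unfold CutoffDefectTable.bound
  simp
  ring

/-- `T.bound a 2 = N₂·a₀ + (2·Mc[2,1,1] + Tt[2,1])·a₁ + (Tu₂ + N0)·a₂ + Td·a₃`. -/
theorem CutoffDefectTable.bound_two (T : CutoffDefectTable) (a : ℕ → ℝ) :
    T.bound a 2 = T.N 2 * a 0 + (2 * T.Mc 2 1 1 + T.Tt 2 1) * a 1 + (T.Tu 2 + T.N0) * a 2 + T.Td * a 3 := by
  unfold CutoffDefectTable.bound
  have e2 : Finset.Ico 1 2 = {1} := by decide
  simp [e2, Nat.choose]
  ring

/-- `T.bound a 3 = N₃·a₀ + (3·Mc[3,1,1] + 3·Mc[3,2,1] + Tt[3,1])·a₁ + (3·Mc[3,1,2] + Tt[3,2])·a₂ + (Tu₃ + N0)·a₃ + Td·a₄`. -/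
theorem CutoffDefectTable.bound_three (T : CutoffDefectTable) (a : ℕ → ℝ) :
    T.bound a 3 = T.N 3 * a 0 + (3 * T.Mc 3 1 1 + 3 * T.Mc 3 2 1 + T.Tt 3 1) * a 1 + (3 * T.Mc 3 1 2 + T.Tt 3 2) * a 2 +
      (T.Tu 3 + T.N0) * a 3 + T.Td * a 4 := by
  unfold CutoffDefectTable.bound
  have e3 : Finset.Ico 1 3 = {1, 2} := by decide
  have e1 : Finset.Icc 1 (3 - 1) = {1, 2} := by decide
  simp [e3, e1, Nat.choose, Finset.sum_insert]
  ring

/-- `T.bound a 4 = N₄·a₀ + (4·Mc[4,1,1] + 6·Mc[4,2,1] + 4·Mc[4,3,1] + Tt[4,1])·a₁ + (4·Mc[4,1,2] + 6·Mc[4,2,2] + Tt[4,2])·a₂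
+ (4·Mc[4,1,3] + Tt[4,3])·a₃ + (Tu₄ + N0)·a₄ + Td·a₅`. -/
theorem CutoffDefectTable.bound_four (T : CutoffDefectTable) (a : ℕ → ℝ) :
    T.bound a 4 = T.N 4 * a 0 + (4 * T.Mc 4 1 1 + 6 * T.Mc 4 2 1 + 4 * T.Mc 4 3 1 + T.Tt 4 1) * a 1 +
      (4 * T.Mc 4 1 2 + 6 * T.Mc 4 2 2 + T.Tt 4 2) * a 2 + (4 * T.Mc 4 1 3 + T.Tt 4 3) * a 3 + (T.Tu 4 + T.N0) * a 4 + T.Td * a 5 := by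
  unfold CutoffDefectTable.bound
  have e4 : Finset.Ico 1 4 = {1, 2, 3} := by decide
  have e1 : Finset.Icc 1 (4 - 1) = {1, 2, 3} := by decide
  have e2 : Finset.Icc 1 (4 - 2) = {1, 2} := by decide
  simp [e4, e1, e2, Nat.choose, Finset.sum_insert]
  ring

/-! ## §2 The no-rate form `T.boundNR a k`, `k = 1 … 4` -/

/-- `T.boundNR a 1 = N₁·a₀ + (Tu₁ + 2 + N0)·a₁`. -/
theorem CutoffDefectTable.boundNR_one (T : CutoffDefectTable) (a : ℕ → ℝ) :
    T.boundNR a 1 = T.N 1 * a 0 + (T.Tu 1 + 2 + T.N0) * a 1 := by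
  rw [CutoffDefectTable.boundNR_eq_bound_sub_add, CutoffDefectTable.bound_one]
  ring

/-- `T.boundNR a 2 = N₂·a₀ + (2·Mc[2,1,1] + Tt[2,1])·a₁ + (Tu₂ + 2 + N0)·a₂`. -/
theorem CutoffDefectTable.boundNR_two (T : CutoffDefectTable) (a : ℕ → ℝ) :
    T.boundNR a 2 = T.N 2 * a 0 + (2 * T.Mc 2 1 1 + T.Tt 2 1) * a 1 + (T.Tu 2 + 2 + T.N0) * a 2 := by
  rw [CutoffDefectTable.boundNR_eq_bound_sub_add, CutoffDefectTable.bound_two]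
  ring

/-- `T.boundNR a 3 = N₃·a₀ + (3·Mc[3,1,1] + 3·Mc[3,2,1] + Tt[3,1])·a₁ + (3·Mc[3,1,2] + Tt[3,2])·a₂ + (Tu₃ + 2 + N0)·a₃`. -/
theorem CutoffDefectTable.boundNR_three (T : CutoffDefectTable) (a : ℕ → ℝ) :
    T.boundNR a 3 = T.N 3 * a 0 + (3 * T.Mc 3 1 1 + 3 * T.Mc 3 2 1 + T.Tt 3 1) * a 1 + (3 * T.Mc 3 1 2 + T.Tt 3 2) * a 2 +
      (T.Tu 3 + 2 + T.N0) * a 3 := by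
  rw [CutoffDefectTable.boundNR_eq_bound_sub_add, CutoffDefectTable.bound_three]
  ring

/-- **The top row a `C⁴` history pays**: `T.boundNR a 4 = N₄·a₀ + (4·Mc[4,1,1] + 6·Mc[4,2,1] + 4·Mc[4,3,1] + Tt[4,1])·a₁
+ (4·Mc[4,1,2] + 6·Mc[4,2,2] + Tt[4,2])·a₂ + (4·Mc[4,1,3] + Tt[4,3])·a₃ + (Tu₄ + 2 + N0)·a₄`. -/
theorem CutoffDefectTable.boundNR_four (T : CutoffDefectTable) (a : ℕ → ℝ) :
    T.boundNR a 4 = T.N 4 * a 0 + (4 * T.Mc 4 1 1 + 6 * T.Mc 4 2 1 + 4 * T.Mc 4 3 1 + T.Tt 4 1) * a 1 +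
      (4 * T.Mc 4 1 2 + 6 * T.Mc 4 2 2 + T.Tt 4 2) * a 2 + (4 * T.Mc 4 1 3 + T.Tt 4 3) * a 3 + (T.Tu 4 + 2 + T.N0) * a 4 := by
  rw [CutoffDefectTable.boundNR_eq_bound_sub_add, CutoffDefectTable.bound_four]
  ring

end Summit.HubbardSuperconductivity.HubbardSuperconductivity.Theorems.KLRegimeSplit

end
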